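import Summits.QuantumFields.YangMills.Theorems.BalabanUVNodesN14LawChannelTunedPath
import Summits.QuantumFields.YangMills.Theorems.BalabanUVNodesN14LawChannelTuned

/-!
# BalabanUVNodes ∕ node N14 = NE1′ — LENS control CARD 11 END TO END FROM PRIMITIVE DATA (K11c′ ∘ K11c ∘ K11a ∘ K11b composed): response, detuning,
# and the oscillation of the conditioned countertermed defect over a COMPACT parameter box ⇒ the one-step matching and the Cauchy property

Cell `pub-ymgap`, HUMAN RULING D-0062 (Track A at full width), seat `pub-ymgap-dag-n14-c` (R134 ACCELERATION, strategy s1), generation 7; route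
`Summits/QuantumFields/YangMills/Theses/BalabanUVNodes.lean` rev 18∕19 (cluster K3⁗ `SpineGivenEndpointR13Sep` = stmt-QuantumFields-20292, `--kind proof --supports … --as
helper`); venue ruling R424 (`YangMills/Theorems`, namespace `YMDAG.N14.LawChannelTunedEndToEnd`).  ADDITIVE — imports this seat's `…N14LawChannelTunedPath` (v1.1: K11c′
with the AFFINE target and the bracket from the DETUNING) and `…N14LawChannelTuned` (K11b), hence dag-n19-c's modules I–II (`…N19TiltPathCalculus`, `…N19TiltPathEndpoints`:
Feynman–Hellmann on a tilt path, K11-FH ∕ K11a ∕ K11c — CITED) and file P (`abs_cov_le_of_condExp`); THEOREMS ONLY (0 `def`), modifies nothing.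

WHY.  The four Card-11 modules in the tree state the channel with the counterterm `κ` as a HYPOTHESIS (K11a ∕ K11b: «for ANY C¹ `κ` with `κ 0 = κ 1 = 0` …») and produce
`κ` separately (K11c′).  A producer at the record cannot check an oscillation hypothesis «along the tuned `κ`» before `κ` is known; what it CAN check is the oscillation over
a COMPACT BOX of counterterm values and rates.  This file composes the modules into statements whose hypotheses are PRIMITIVE (no `∃κ`, no `κ` inside): (i) the uniform
RESPONSE `Cov_{s,u,v}(R, S) ≥ γ` of a renormalisation observable `R` to the marginal monomial `S` on the strip `[0,1] × [−V, V]`; (ii) the straight chord's DETUNING of `R`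
within the window's reach `γ·V`; (iii) the covariances of the observable `F` with the COUNTERTERMED DIRECTIONS `D + w·S` — equivalently (file P) the L¹-oscillation of the
CONDITIONED countertermed defect `μ_{s,u,v}[D + w·S | m]` — bounded over the box `|v| ≤ V`, `|w| ≤ W := (|r₁ − r₀| + 2·C_R·C_D)∕γ`, where `W` bounds the tuned rate
`κ′` by the FEEDBACK LAW.

WHAT THIS IS.
* §1 [folklore] `abs_cov_le_two_mul` (`|Cov(R,g)| ≤ 2·C_R·C_g`), ★ `abs_deriv_counterterm_le` (the feedback law for the AFFINE target `(1−u)r₀ + u r₁`: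
  `κ′(u)·Cov_u(R,S) = (r₁ − r₀) − Cov_u(R,D)` on `(0,1)` — module I's FH with `f := R` + uniqueness of derivatives — hence `|κ′| ≤ W` on `(0,1)`, and on `[0,1]` by continuity
  of `κ′` and `closure (0,1) = [0,1]`), ★★ `abs_tiltedMean_tilted_sub_le_of_tunedData` (ONE STEP FROM PRIMITIVE DATA: (i) + (ii) + (iii) in covariance form ⇒
  `|tiltedMean F (μ.tilted D) s − tiltedMean F μ s| ≤ c`; the counterterm is PRODUCED by `exists_tuned_path_affine_of_detuning`, its rate BOUNDED by the feedback law,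
  and dag-n19-c's K11a closes).
* §2 [folklore ∘ §1 + file P + `T4CauchySum`] `abs_tiltedMean_succ_sub_le_of_tunedData` (the tower step in CONDITIONED form: push-forward + fibre-blind observable +
  (i)(ii)(iii) per run and source, (iii) as the L¹-oscillation bound `b K` of `μ_{s,u,v}[D K + w·S K | m K]` over the box ⇒ `≤ B₀·b K`), ★★ `cauchySeq_genFun_of_tunedData`
  ((F2″) FROM PRIMITIVE DATA: `Σ b K < ∞` ⇒ the generating functions are Cauchy).

WHAT THIS IS NOT.  Everything here is PROVED (0 `sorry`, 0 named facts) on hypothesis shapes; LENS control's CURRENCY (F2″) — «a repaired currency, NOT an estimate, NOT on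
N14's critical path; it gains only in PRODUCTION» (memo §B (B3), lens HANDOFF gen 9 (D3)); here the production burden is made explicit and `κ`-free.  Nothing of Bałaban's
(run laws, the defect `D K`, the Wilson monomial `S K`, a renormalisation observable `R K` with response `γ K`) is instantiated; N14 ∕ N19 NOT discharged; count-neutral.
One finite four-torus programme at fixed ε; NOT ℝ⁴, NOT OS, NOT a mass gap, NOT Clay.
-/

set_option autoImplicit false

noncomputable section

namespace YMDAG.N14.LawChannelTunedEndToEnd

open MeasureTheory ProbabilityTheory Set Filter Topology
open scoped ENNReal
open Summit.QuantumFields.BalabanUV.T4Continuum.NE1p.DressedMGFForm (tiltedMean matchingModConstants_of_tiltedMeans)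
open Literature.MathematicalPhysics.QuantumFieldTheory.Balaban1983to89.T4CauchySum (MatchingModConstants genFun cauchySeq_genFun)
open Summit.QuantumFields.YangMills.BalabanUVNodes.N19TiltPathCalculus (integrable_of_abs_le hasDerivAt_integral_tilted_tiltPath_eq_cov)
open Summit.QuantumFields.YangMills.BalabanUVNodes.N19TiltPathEndpoints (tiltPath_bounds_counterterm hasDerivAt_integral_tilted_counterterm
  abs_tiltedMean_tilted_sub_le_of_cov_counterterm)
open YMDAG.N14.LawChannel (abs_cov_le_of_condExp isProbabilityMeasure_tilted_of_abs_le)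
open YMDAG.N14.LawChannelTunedPath (exists_tuned_path_affine_of_detuning abs_chord_le measurable_chord)
open YMDAG.N14.ConvexFibreCauchy (tiltedMean_map)

/-! ## §1 One step at fixed source `s`: the feedback law for the AFFINE target bounds the counterterm rate, and K11a closes -/
section OneStep

variable {Ω : Type*} [MeasurableSpace Ω] {μ : Measure Ω} [IsProbabilityMeasure μ] {F D S R : Ω → ℝ} {B₀ CD CS CR s : ℝ}

/-- **A CRUDE COVARIANCE BOUND**: for `|R| ≤ C_R`, `|g| ≤ C_g` on a probability space, `|Cov(R, g)| ≤ 2·C_R·C_g`. [folklore] -/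
theorem abs_cov_le_two_mul {ν : Measure Ω} [IsProbabilityMeasure ν] {g : Ω → ℝ} {Cg : ℝ} (hRm : Measurable R) (hRb : ∀ x, |R x| ≤ CR)
    (hgm : Measurable g) (hgb : ∀ x, |g x| ≤ Cg) : |cov[R, g; ν]| ≤ 2 * CR * Cg := by
  have hRt : MemLp R 2 ν := MemLp.of_bound hRm.aestronglyMeasurable CR (Eventually.of_forall fun x => by rw [Real.norm_eq_abs]; exact hRb x)
  have hgt : MemLp g 2 ν := MemLp.of_bound hgm.aestronglyMeasurable Cg (Eventually.of_forall fun x => by rw [Real.norm_eq_abs]; exact hgb x)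
  have hCR : 0 ≤ CR := by
    obtain ⟨x⟩ := nonempty_of_measure_ne_zero (μ := ν) (s := Set.univ) (by simp)
    exact (abs_nonneg _).trans (hRb x)
  have hCg : 0 ≤ Cg := by
    obtain ⟨x⟩ := nonempty_of_measure_ne_zero (μ := ν) (s := Set.univ) (by simp)
    exact (abs_nonneg _).trans (hgb x)
  rw [covariance_eq_sub hRt hgt]
  have h1 : |∫ x, (R * g) x ∂ν| ≤ CR * Cg := by
    refine (abs_integral_le_integral_abs).trans ?_
    have := integral_mono_of_nonneg (μ := ν) (Eventually.of_forall fun x => abs_nonneg ((R * g) x)) (integrable_const (CR * Cg))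
      (Eventually.of_forall fun x => by
        show |(R * g) x| ≤ CR * Cg
        rw [Pi.mul_apply, abs_mul]; exact mul_le_mul (hRb x) (hgb x) (abs_nonneg _) hCR)
    simpa using this
  have h2 : |∫ x, R x ∂ν| ≤ CR := by
    refine (abs_integral_le_integral_abs).trans ?_
    have := integral_mono_of_nonneg (μ := ν) (Eventually.of_forall fun x => abs_nonneg (R x)) (integrable_const CR)
      (Eventually.of_forall fun x => hRb x)
    simpa using this
  have h3 : |∫ x, g x ∂ν| ≤ Cg := by
    refine (abs_integral_le_integral_abs).trans ?_
    have := integral_mono_of_nonneg (μ := ν) (Eventually.of_forall fun x => abs_nonneg (g x)) (integrable_const Cg)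
      (Eventually.of_forall fun x => hgb x)
    simpa using this
  calc |∫ x, (R * g) x ∂ν - (∫ x, R x ∂ν) * ∫ x, g x ∂ν| ≤ |∫ x, (R * g) x ∂ν| + |(∫ x, R x ∂ν) * ∫ x, g x ∂ν| := abs_sub _ _
    _ = |∫ x, (R * g) x ∂ν| + |∫ x, R x ∂ν| * |∫ x, g x ∂ν| := by rw [abs_mul]
    _ ≤ CR * Cg + CR * Cg := add_le_add h1 (mul_le_mul h2 h3 (abs_nonneg _) hCR)
    _ = 2 * CR * Cg := by ring

/-- **THE FEEDBACK LAW FOR THE AFFINE TARGET BOUNDS THE COUNTERTERM RATE**: if `∫ R dμ♮_u = (1−u)·r₀ + u·r₁` on `[0,1]` along the countertermed chord, then on `(0,1)`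
`κ′(u)·Cov_u(R,S) = (r₁ − r₀) − Cov_u(R,D)` (K11-FH with `F := R` + uniqueness of the derivative of the affine target); with the response `Cov_u(R,S) ≥ γ > 0` at the
points `(u, κ u)` this gives `|κ′ u| ≤ (|r₁ − r₀| + 2·C_R·C_D) ∕ γ` on `(0,1)`, and on `[0,1]` by continuity of `κ′`. [folklore ∘ dag-n19-c K11-FH ∕ K11c] -/
theorem abs_deriv_counterterm_le (hRm : Measurable R) (hRb : ∀ x, |R x| ≤ CR) (hFm : Measurable F) (hFb : ∀ x, |F x| ≤ B₀)
    (hDm : Measurable D) (hDb : ∀ x, |D x| ≤ CD) (hSm : Measurable S) (hSb : ∀ x, |S x| ≤ CS) {κ κ' : ℝ → ℝ} {γ r₀ r₁ : ℝ} (hγ : 0 < γ)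
    (hκ : ∀ u, HasDerivAt κ (κ' u) u) (hκ' : Continuous κ')
    (hresp : ∀ u ∈ Set.Icc (0 : ℝ) 1, γ ≤ cov[R, S; μ.tilted fun x => s * F x + u * D x + κ u * S x])
    (htuned : ∀ u ∈ Set.Icc (0 : ℝ) 1, ∫ x, R x ∂(μ.tilted fun x => s * F x + u * D x + κ u * S x) = (1 - u) * r₀ + u * r₁) :
    ∀ u ∈ Set.Icc (0 : ℝ) 1, |κ' u| ≤ (|r₁ - r₀| + 2 * CR * CD) / γ := by
  -- on the open interval: the feedback law
  have hopen : ∀ u ∈ Set.Ioo (0 : ℝ) 1, |κ' u| ≤ (|r₁ - r₀| + 2 * CR * CD) / γ := by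
    intro u hu
    set ν : Measure Ω := μ.tilted fun x => s * F x + u * D x + κ u * S x with hν
    obtain ⟨ε, hε, M, hM⟩ := tiltPath_bounds_counterterm (s := s) hFb hDb hSb hκ hκ' u
    haveI : IsProbabilityMeasure ν := isProbabilityMeasure_tilted
      (integrable_of_abs_le (Real.measurable_exp.comp (measurable_chord hFm hDm hSm u (κ u))) fun x => by
        rw [Real.abs_exp]; exact Real.exp_le_exp.2 ((le_abs_self _).trans (hM u (Metric.mem_ball_self hε) x).1))
    -- K11-FH with `F := R`, and the derivative of the affine target
    have hFH := hasDerivAt_integral_tilted_tiltPath_eq_cov (μ := μ) (u₀ := u) (ψ := fun u x => s * F x + u * D x + κ u * S x)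
      (ψ' := fun u x => D x + κ' u * S x) (fun t => measurable_chord hFm hDm hSm t (κ t)) (fun _ => hDm.add (measurable_const.mul hSm))
      (fun t x => (((hasDerivAt_mul_const (D x)).const_add (s * F x)).add ((hκ t).mul_const (S x))))
      (tiltPath_bounds_counterterm hFb hDb hSb hκ hκ' u) hRm hRb
    have haff : HasDerivAt (fun u : ℝ => ∫ x, R x ∂(μ.tilted fun x => s * F x + u * D x + κ u * S x)) (r₁ - r₀) u := by
      have h := (((hasDerivAt_id u).const_sub 1).mul_const r₀).add ((hasDerivAt_id u).mul_const r₁)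
      have h' : HasDerivAt (fun t : ℝ => (1 - t) * r₀ + t * r₁) (r₁ - r₀) u :=
        (h.congr_of_eventuallyEq (Eventually.of_forall fun t => rfl)).congr_deriv (by ring)
      refine h'.congr_of_eventuallyEq ?_
      filter_upwards [Icc_mem_nhds hu.1 hu.2] with v hv using htuned v hv
    have heq : cov[R, fun x => D x + κ' u * S x; ν] = r₁ - r₀ := hFH.unique haff
    -- split the covariance
    have hbd' : ∀ {g : Ω → ℝ} {C : ℝ}, Measurable g → (∀ x, |g x| ≤ C) → MemLp g 2 ν := fun hg hC =>
      MemLp.of_bound hg.aestronglyMeasurable _ (Eventually.of_forall fun x => by rw [Real.norm_eq_abs]; exact hC x)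
    have hSm' : Measurable fun x => κ' u * S x := measurable_const.mul hSm
    have hSb' : ∀ x, |κ' u * S x| ≤ |κ' u| * CS := fun x => by
      rw [abs_mul]; exact mul_le_mul_of_nonneg_left (hSb x) (abs_nonneg _)
    have hsplit : cov[R, fun x => D x + κ' u * S x; ν] = cov[R, D; ν] + κ' u * cov[R, S; ν] := by
      have e : (fun x => D x + κ' u * S x) = D + fun x => κ' u * S x := by ext x; simp
      rw [e, covariance_add_right (hbd' hRm hRb) (hbd' hDm hDb) (hbd' hSm' hSb'), covariance_const_mul_right]
    rw [hsplit] at heq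
    have hcovD : |cov[R, D; ν]| ≤ 2 * CR * CD := abs_cov_le_two_mul hRm hRb hDm hDb
    have hγu : γ ≤ cov[R, S; ν] := hresp u ⟨hu.1.le, hu.2.le⟩
    have hpos : 0 < cov[R, S; ν] := hγ.trans_le hγu
    have hk : κ' u = ((r₁ - r₀) - cov[R, D; ν]) / cov[R, S; ν] := by
      field_simp; linarith
    rw [hk, abs_div, abs_of_pos hpos, div_le_div_iff₀ hpos hγ]
    calc |r₁ - r₀ - cov[R, D; ν]| * γ ≤ (|r₁ - r₀| + 2 * CR * CD) * γ := by
          refine mul_le_mul_of_nonneg_right ((abs_sub _ _).trans (add_le_add le_rfl hcovD)) hγ.le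
      _ ≤ (|r₁ - r₀| + 2 * CR * CD) * cov[R, S; ν] := by
          refine mul_le_mul_of_nonneg_left hγu ?_
          have : 0 ≤ 2 * CR * CD := by
            have h := abs_cov_le_two_mul (ν := ν) hRm hRb hDm hDb
            exact (abs_nonneg _).trans h
          positivity
  -- on the closed interval, by continuity of `κ'`
  intro u hu
  have hclosed : IsClosed {u : ℝ | |κ' u| ≤ (|r₁ - r₀| + 2 * CR * CD) / γ} :=
    isClosed_le (continuous_abs.comp hκ') continuous_const
  have hsub : Set.Icc (0 : ℝ) 1 ⊆ {u : ℝ | |κ' u| ≤ (|r₁ - r₀| + 2 * CR * CD) / γ} := by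
    rw [← closure_Ioo (zero_ne_one' ℝ), hclosed.closure_subset_iff]
    exact hopen
  exact hsub hu

/-- **CARD 11 AT ONE STEP FROM PRIMITIVE DATA** (K11c′ ∘ K11c ∘ K11a composed; fixed source `s`).  Bounded measurable `F` (observable), `D` (one-step defect), `S` (marginal
monomial), `R` (renormalisation observable) on a probability space `μ`; on the strip `u ∈ [0,1]`, `v ∈ [-V, V]`: (i) RESPONSE `Cov_{s,u,v}(R, S) ≥ γ > 0`; (ii) DETUNING
within reach — along the STRAIGHT chord the mean of `R` never leaves the chord of its endpoint values by more than `γ·V`; (iii) the covariances of `F` with the COUNTERTERMED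
DIRECTIONS `D + w·S`, `|w| ≤ W := (|r₁ − r₀| + 2·C_R·C_D)∕γ`, are `≤ c` on the strip.  Then `|tiltedMean F (μ.tilted D) s − tiltedMean F μ s| ≤ c`.  The counterterm is
PRODUCED (`exists_tuned_path_affine_of_detuning`), its rate is BOUNDED (`abs_deriv_counterterm_le`), and K11a closes. [folklore ∘ this lineage + dag-n19-c] -/
theorem abs_tiltedMean_tilted_sub_le_of_tunedData (hRm : Measurable R) (hRb : ∀ x, |R x| ≤ CR) (hFm : Measurable F) (hFb : ∀ x, |F x| ≤ B₀)
    (hDm : Measurable D) (hDb : ∀ x, |D x| ≤ CD) (hSm : Measurable S) (hSb : ∀ x, |S x| ≤ CS) {γ V c : ℝ} (hγ : 0 < γ) (hV : 0 < V)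
    (hresp : ∀ u ∈ Set.Icc (0 : ℝ) 1, ∀ v ∈ Set.Icc (-V) V, γ ≤ cov[R, S; μ.tilted fun x => s * F x + u * D x + v * S x])
    (hdetune : ∀ u ∈ Set.Icc (0 : ℝ) 1,
      |(∫ x, R x ∂(μ.tilted fun x => s * F x + u * D x)) -
        ((1 - u) * (∫ x, R x ∂(μ.tilted fun x => s * F x)) + u * (∫ x, R x ∂(μ.tilted fun x => s * F x + D x)))| ≤ γ * V)
    (hosc : ∀ u ∈ Set.Icc (0 : ℝ) 1, ∀ v ∈ Set.Icc (-V) V, ∀ w : ℝ,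
      |w| ≤ (|(∫ x, R x ∂(μ.tilted fun x => s * F x + D x)) - ∫ x, R x ∂(μ.tilted fun x => s * F x)| + 2 * CR * CD) / γ →
        |cov[F, fun x => D x + w * S x; μ.tilted fun x => s * F x + u * D x + v * S x]| ≤ c) :
    |tiltedMean F (μ.tilted D) s - tiltedMean F μ s| ≤ c := by
  set r₀ : ℝ := ∫ x, R x ∂(μ.tilted fun x => s * F x) with hr₀
  set r₁ : ℝ := ∫ x, R x ∂(μ.tilted fun x => s * F x + D x) with hr₁
  obtain ⟨κ, κ', hκ, hκ'c, hκ0, hκ1, hκm, hκz⟩ :=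
    exists_tuned_path_affine_of_detuning (μ := μ) (s := s) (r₀ := r₀) (r₁ := r₁) hRm hRb hFm hFb hDm hDb hSm hSb hγ hV hresp hdetune rfl rfl
  have hW := abs_deriv_counterterm_le (μ := μ) (s := s) hRm hRb hFm hFb hDm hDb hSm hSb hγ hκ hκ'c (fun u hu => hresp u hu _ (hκm u hu)) hκz
  exact abs_tiltedMean_tilted_sub_le_of_cov_counterterm hFm hFb hDm hDb hSm hSb hκ hκ'c hκ0 hκ1 fun u hu => hosc u hu _ (hκm u hu) _ (hW u hu)

end OneStep


/-! ## §2 The tower: (F2″) FROM PRIMITIVE DATA — response, detuning, and the summable oscillation of the conditioned countertermed defect over the box -/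
section Tower

variable {Ω : ℕ → Type*} {m : ∀ K, MeasurableSpace (Ω K)} [mΩ : ∀ K, MeasurableSpace (Ω K)] {l₀ B₀ vol : ℝ} {CD CS CR γ V b : ℕ → ℝ}
  {μ : ∀ K, Measure (Ω K)} {π : ∀ K, Ω (K + 1) → Ω K} {F D S R : ∀ K, Ω K → ℝ} {Z : ℕ → ℝ → ℝ}

/-- **THE ONE-STEP MATCHING FROM PRIMITIVE DATA, CONDITIONED FORM.**  Run laws `μ K` (probability), push-forward `(μ (K+1)).map (π K) = (μ K).tilted (D K)`, fibre-blind
observables `F (K+1) = F K ∘ π K` with `F K` measurable for the unit-field σ-algebra `m K`; per run `K` and source `|s| ≤ l₀`: response `γ K`, window `V K`, detuning within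
reach, and the L¹-oscillation of the CONDITIONED COUNTERTERMED defect `μ_{s,u,v}[D K + w·S K | m K]` bounded by `b K` over the COMPACT box `u ∈ [0,1]`, `|v| ≤ V K`,
`|w| ≤ W K s := (|r₁ − r₀| + 2·C_R·C_D)∕γ K`.  Then `|tiltedMean (F (K+1)) (μ (K+1)) s − tiltedMean (F K) (μ K) s| ≤ B₀·b K`. [folklore ∘ §1 + file P `abs_cov_le_of_condExp`] -/
theorem abs_tiltedMean_succ_sub_le_of_tunedData (hμ : ∀ K, IsProbabilityMeasure (μ K)) (hπ : ∀ K, Measurable (π K)) (hm : ∀ K, m K ≤ mΩ K)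
    (hFm : ∀ K, StronglyMeasurable[m K] (F K)) (hFb : ∀ K x, |F K x| ≤ B₀) (hFπ : ∀ K ω, F (K + 1) ω = F K (π K ω))
    (hDm : ∀ K, Measurable (D K)) (hDb : ∀ K x, |D K x| ≤ CD K) (hpush : ∀ K, (μ (K + 1)).map (π K) = (μ K).tilted (D K))
    (hSm : ∀ K, Measurable (S K)) (hSb : ∀ K x, |S K x| ≤ CS K) (hRm : ∀ K, Measurable (R K)) (hRb : ∀ K x, |R K x| ≤ CR K)
    (hγ : ∀ K, 0 < γ K) (hV : ∀ K, 0 < V K)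
    (hresp : ∀ K (s : ℝ), |s| ≤ l₀ → ∀ u ∈ Set.Icc (0 : ℝ) 1, ∀ v ∈ Set.Icc (-(V K)) (V K),
      γ K ≤ cov[R K, S K; (μ K).tilted fun x => s * F K x + u * D K x + v * S K x])
    (hdetune : ∀ K (s : ℝ), |s| ≤ l₀ → ∀ u ∈ Set.Icc (0 : ℝ) 1,
      |(∫ x, R K x ∂((μ K).tilted fun x => s * F K x + u * D K x)) -
        ((1 - u) * (∫ x, R K x ∂((μ K).tilted fun x => s * F K x)) + u * (∫ x, R K x ∂((μ K).tilted fun x => s * F K x + D K x)))| ≤ γ K * V K)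
    (hb : ∀ K (s : ℝ), |s| ≤ l₀ → ∀ u ∈ Set.Icc (0 : ℝ) 1, ∀ v ∈ Set.Icc (-(V K)) (V K), ∀ w : ℝ,
      |w| ≤ (|(∫ x, R K x ∂((μ K).tilted fun x => s * F K x + D K x)) - ∫ x, R K x ∂((μ K).tilted fun x => s * F K x)| + 2 * CR K * CD K) / γ K →
        ∫ x, |(((μ K).tilted fun x => s * F K x + u * D K x + v * S K x)[fun x => D K x + w * S K x|m K]) x -
            ∫ y, (D K y + w * S K y) ∂((μ K).tilted fun x => s * F K x + u * D K x + v * S K x)|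
          ∂((μ K).tilted fun x => s * F K x + u * D K x + v * S K x) ≤ b K)
    (K : ℕ) {s : ℝ} (hs : |s| ≤ l₀) :
    |tiltedMean (F (K + 1)) (μ (K + 1)) s - tiltedMean (F K) (μ K) s| ≤ B₀ * b K := by
  haveI := hμ K
  have hFm₀ : Measurable (F K) := ((hFm K).mono (hm K)).measurable
  have hB₀ : 0 ≤ B₀ := by
    obtain ⟨x⟩ := nonempty_of_measure_ne_zero (μ := μ K) (s := Set.univ) (by simp)
    exact (abs_nonneg _).trans (hFb K x)
  have hcomp : F (K + 1) = (F K) ∘ π K := funext (hFπ K)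
  rw [hcomp, ← tiltedMean_map (hπ K) hFm₀, hpush K]
  refine abs_tiltedMean_tilted_sub_le_of_tunedData (μ := μ K) (s := s) (hRm K) (hRb K) hFm₀ (hFb K) (hDm K) (hDb K) (hSm K) (hSb K)
    (hγ K) (hV K) (hresp K s hs) (hdetune K s hs) fun u hu v hv w hw => ?_
  haveI : IsProbabilityMeasure ((μ K).tilted fun x => s * F K x + u * D K x + v * S K x) :=
    isProbabilityMeasure_tilted_of_abs_le (ν := μ K) (C := |s| * B₀ + |u| * CD K + |v| * CS K) (measurable_chord hFm₀ (hDm K) (hSm K) u v)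
      fun x => abs_chord_le (hFb K) (hDb K) (hSb K) u v x
  have hdirm : Measurable fun x => D K x + w * S K x := (hDm K).add (measurable_const.mul (hSm K))
  have hdirb : ∀ x, |D K x + w * S K x| ≤ CD K + |w| * CS K := fun x =>
    (abs_add_le _ _).trans (add_le_add (hDb K x) (by rw [abs_mul]; exact mul_le_mul_of_nonneg_left (hSb K x) (abs_nonneg _)))
  exact (abs_cov_le_of_condExp (hm K) (hFm K) (hFb K) hdirm hdirb).trans (mul_le_mul_of_nonneg_left (hb K s hs u hu v hv w hw) hB₀)

/-- **★ CARD 11 END TO END — (F2″) FROM PRIMITIVE DATA ⇒ CAUCHY GENERATING FUNCTIONS.**  Under the hypotheses of the previous theorem for every run `K`, with `vol > 0`,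
`l₀ ≥ 0`, `Σ b K < ∞` and `Z K t = mgf (F K) (μ K) t`: `K ↦ genFun Z K t` is Cauchy for every `|t| ≤ l₀` (`η K = B₀·b K`).  This is K11b with the counterterm PRODUCED
(K11c′, affine target, bracket from the detuning) and its rate BOUNDED (feedback law) — the hypotheses are the three things a producer must supply at the record: the
uniform response of a renormalisation observable to the Wilson monomial, the straight chord's detuning within the window's reach, and the summable oscillation of the
conditioned countertermed defect over a compact parameter box.  NOT PRINTED for YM₄; produced by nobody (NODE O ∕ NE5–NE7).
[folklore ∘ the previous theorem + `matchingModConstants_of_tiltedMeans` + `T4CauchySum.cauchySeq_genFun`] -/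
theorem cauchySeq_genFun_of_tunedData (hvol : 0 < vol) (hl₀ : 0 ≤ l₀)
    (hμ : ∀ K, IsProbabilityMeasure (μ K)) (hπ : ∀ K, Measurable (π K)) (hm : ∀ K, m K ≤ mΩ K)
    (hFm : ∀ K, StronglyMeasurable[m K] (F K)) (hFb : ∀ K x, |F K x| ≤ B₀) (hFπ : ∀ K ω, F (K + 1) ω = F K (π K ω))
    (hDm : ∀ K, Measurable (D K)) (hDb : ∀ K x, |D K x| ≤ CD K) (hpush : ∀ K, (μ (K + 1)).map (π K) = (μ K).tilted (D K))
    (hSm : ∀ K, Measurable (S K)) (hSb : ∀ K x, |S K x| ≤ CS K) (hRm : ∀ K, Measurable (R K)) (hRb : ∀ K x, |R K x| ≤ CR K)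
    (hγ : ∀ K, 0 < γ K) (hV : ∀ K, 0 < V K)
    (hresp : ∀ K (s : ℝ), |s| ≤ l₀ → ∀ u ∈ Set.Icc (0 : ℝ) 1, ∀ v ∈ Set.Icc (-(V K)) (V K),
      γ K ≤ cov[R K, S K; (μ K).tilted fun x => s * F K x + u * D K x + v * S K x])
    (hdetune : ∀ K (s : ℝ), |s| ≤ l₀ → ∀ u ∈ Set.Icc (0 : ℝ) 1,
      |(∫ x, R K x ∂((μ K).tilted fun x => s * F K x + u * D K x)) -
        ((1 - u) * (∫ x, R K x ∂((μ K).tilted fun x => s * F K x)) + u * (∫ x, R K x ∂((μ K).tilted fun x => s * F K x + D K x)))| ≤ γ K * V K)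
    (hb : ∀ K (s : ℝ), |s| ≤ l₀ → ∀ u ∈ Set.Icc (0 : ℝ) 1, ∀ v ∈ Set.Icc (-(V K)) (V K), ∀ w : ℝ,
      |w| ≤ (|(∫ x, R K x ∂((μ K).tilted fun x => s * F K x + D K x)) - ∫ x, R K x ∂((μ K).tilted fun x => s * F K x)| + 2 * CR K * CD K) / γ K →
        ∫ x, |(((μ K).tilted fun x => s * F K x + u * D K x + v * S K x)[fun x => D K x + w * S K x|m K]) x -
            ∫ y, (D K y + w * S K y) ∂((μ K).tilted fun x => s * F K x + u * D K x + v * S K x)|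
          ∂((μ K).tilted fun x => s * F K x + u * D K x + v * S K x) ≤ b K)
    (hbs : Summable b) (hZ : ∀ K t, Z K t = mgf (F K) (μ K) t) {t : ℝ} (ht : |t| ≤ l₀) :
    CauchySeq fun K => genFun Z K t := by
  haveI : ∀ K, IsFiniteMeasure (μ K) := fun K => by haveI := hμ K; infer_instance
  have hFm₀ : ∀ K, Measurable (F K) := fun K => ((hFm K).mono (hm K)).measurable
  have hMC : MatchingModConstants vol l₀ (fun K => l₀ / vol * (B₀ * b K)) Z :=
    matchingModConstants_of_tiltedMeans (μ := μ) (η := fun K => B₀ * b K) hFm₀ hFb hZ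
      (fun K s hs => abs_tiltedMean_succ_sub_le_of_tunedData hμ hπ hm hFm hFb hFπ hDm hDb hpush hSm hSb hRm hRb hγ hV hresp hdetune hb K hs)
      (fun K => le_of_eq (by field_simp))
  exact cauchySeq_genFun hMC hl₀ ((hbs.mul_left B₀).mul_left _) ht

end Tower

end YMDAG.N14.LawChannelTunedEndToEnd

end
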